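import Literature.AnabelianGeometry.SemiGraphs.TemperedGroups
import Mathlib.GroupTheory.GroupAction.SubMulAction
import Mathlib.CategoryTheory.Limits.Shapes.BinaryProducts
import Mathlib.Tactic.Group
import HarnessLib

/-!
# Semi-graphs of anabelioids, §3: proofs of the named facts of `TemperedGroups.lean`

Mochizuki, *Semi-graphs of anabelioids*, Publ. RIMS **42** (2006), §3 pp. 33–34
[cite: MochizukiSemiAnbd2006, §3 pp.33-34].  The statement file
`Literature.AnabelianGeometry.SemiGraphs.TemperedGroups` records three sentences of
Remarks 3.1.1–3.1.2 as named facts; this proof-only companion discharges them: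

* `quotientHomCosetDescription_holds` — Remark 3.1.2: `Π`-maps `Π/H₁ → Π/H₂` correspond
  bijectively (via `f ↦ f(1 · H₁)`) to the cosets `h · H₂` with `h⁻¹ H₁ h ⊆ H₂`;
* `countableHomOfConnected_holds` — Remark 3.1.2: `Hom(T₁, T₂)` is countable for `T₁` connected
  in `B^temp(Π)` (a connected object has at most one orbit, so a map is determined by one value);
* `countablyGeneratedOfCountableSystem_holds` — Remark 3.1.1: a tempered group presented by a
  countable cofinal system of open normal subgroups of countable index is (topologically)
  countably generated (representatives of the countably many countable quotients are dense).

Proof-only: no definitions, nothing of the statement file is restated; the auxiliary objects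
(sub-`Π`-sets, the empty `Π`-set, comparison maps) are built inside the proofs.
-/

open CategoryTheory CategoryTheory.Limits Topology Filter

namespace Literature.AnabelianGeometry.SemiGraphs

universe u

variable {G : Type u} [Group G]

/-! ### Remark 3.1.2: morphisms between coset spaces (pure group theory) -/

/-- Equivariance of a `Π`-map between coset spaces, pointwise, for its underlying function
`φ` (given with its honest type so that the quotient actions are found). [folklore] -/
private theorem quotientHom_smul {H₁ H₂ : Subgroup G}
    (f : Action.ofMulAction G (G ⧸ H₁) ⟶ Action.ofMulAction G (G ⧸ H₂))
    (φ : G ⧸ H₁ → G ⧸ H₂) (hφ : ∀ q, φ q = f.hom q) (g : G) (q : G ⧸ H₁) :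
    φ (g • q) = g • φ q := by
  have h := ConcreteCategory.congr_hom (f.comm g) q
  simp only [types_comp_apply, Action.ofMulAction_apply] at h
  rw [hφ, hφ]
  exact h

/-- A `Π`-map `Π/H₁ → Π/H₂` is determined by its value at the trivial coset. [folklore] -/
private theorem quotientHom_ext {H₁ H₂ : Subgroup G}
    (f f' : Action.ofMulAction G (G ⧸ H₁) ⟶ Action.ofMulAction G (G ⧸ H₂))
    (φ φ' : G ⧸ H₁ → G ⧸ H₂) (hφ : ∀ q, φ q = f.hom q) (hφ' : ∀ q, φ' q = f'.hom q)
    (h : φ ((1 : G) : G ⧸ H₁) = φ' ((1 : G) : G ⧸ H₁)) : f = f' := by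
  apply Action.hom_ext
  apply ConcreteCategory.hom_ext
  intro q
  obtain ⟨a, rfl⟩ := QuotientGroup.mk_surjective q
  have ha : ((a : G) : G ⧸ H₁) = a • ((1 : G) : G ⧸ H₁) := by
    rw [MulAction.Quotient.smul_coe, smul_eq_mul, mul_one]
  rw [← hφ (a : G ⧸ H₁), ← hφ' (a : G ⧸ H₁), ha, quotientHom_smul f φ hφ,
    quotientHom_smul f' φ' hφ', h]

variable [TopologicalSpace G]

variable (G) in
/-- **Remark 3.1.2** (SemiAnbd §3 p. 33), PROVED: "If `H₁, H₂ ⊆ Π` are open, then there is a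
natural bijection between the morphisms `Π/H₁ → Π/H₂` and the cosets `h · H₂` satisfying
`h⁻¹ · H₁ · h ⊆ H₂`", the bijection being `f ↦ f(1 · H₁)` (openness is not needed for this
purely group-theoretic sentence). [cite: MochizukiSemiAnbd2006, Rmk 3.1.2 p.33] -/
theorem quotientHomCosetDescription_holds : QuotientHomCosetDescription G := by
  intro H₁ H₂ _ _
  -- the underlying function of a `Π`-map, with its honest type
  let app : (Action.ofMulAction G (G ⧸ H₁) ⟶ Action.ofMulAction G (G ⧸ H₂)) → G ⧸ H₁ → G ⧸ H₂ :=
    fun f q => f.hom q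
  have happ : ∀ f q, app f q = f.hom q := fun _ _ => rfl
  change Set.BijOn (fun f => app f ((1 : G) : G ⧸ H₁)) Set.univ _
  refine ⟨fun f _ => ?_,
    fun f _ f' _ hff' => quotientHom_ext f f' (app f) (app f') (happ f) (happ f') hff',
    fun q hq => ?_⟩
  · -- maps into the admissible cosets
    obtain ⟨h, hh⟩ := QuotientGroup.mk_surjective (app f ((1 : G) : G ⧸ H₁))
    refine ⟨h, hh.symm, fun x hx => ?_⟩
    have hx1 : x • ((1 : G) : G ⧸ H₁) = ((1 : G) : G ⧸ H₁) := by
      rw [MulAction.Quotient.smul_coe, smul_eq_mul, mul_one, QuotientGroup.eq, mul_one]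
      exact inv_mem hx
    have key : (h : G ⧸ H₂) = ((x * h : G) : G ⧸ H₂) := by
      rw [← smul_eq_mul, ← MulAction.Quotient.smul_coe, hh, ← quotientHom_smul f (app f) (happ f),
        hx1]
    rw [QuotientGroup.eq, ← mul_assoc] at key
    exact key
  · -- every admissible coset `h H₂` is attained, by `a H₁ ↦ a h H₂`
    obtain ⟨h, rfl, hh⟩ := hq
    let ψ : G ⧸ H₁ → G ⧸ H₂ := Quotient.map' (fun a : G => a * h) fun a b hab => by
      have hab' : a⁻¹ * b ∈ H₁ := QuotientGroup.leftRel_apply.mp hab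
      apply QuotientGroup.leftRel_apply.mpr
      have : (a * h)⁻¹ * (b * h) = h⁻¹ * (a⁻¹ * b) * h := by group
      rw [this]
      exact hh _ hab'
    have hψ : ∀ a : G, ψ (a : G ⧸ H₁) = ((a * h : G) : G ⧸ H₂) := fun _ => rfl
    refine ⟨{ hom := TypeCat.ofHom ψ, comm := fun g => ?_ }, Set.mem_univ _, ?_⟩
    · apply ConcreteCategory.hom_ext
      intro q
      obtain ⟨a, rfl⟩ := QuotientGroup.mk_surjective q
      change ψ (g • (a : G ⧸ H₁)) = g • ψ (a : G ⧸ H₁)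
      rw [MulAction.Quotient.smul_coe, smul_eq_mul, hψ, hψ, MulAction.Quotient.smul_coe,
        smul_eq_mul, mul_assoc]
    · change ψ ((1 : G) : G ⧸ H₁) = (h : G ⧸ H₂)
      rw [hψ, one_mul]

variable (G) in
/-- `QuotientHomCosetDescription` — `_holds` alias of `quotientHomCosetDescription_holds` above under the fact's exact name (appended
2026-08-28, D-0026 bookkeeping: the proof term is the existing theorem of this file; no statement,
definition or attribute is edited; no new named fact; the ledger's debt table listed the fact
unproved). [cite: MochizukiSemiAnbd2006, Rmk 3.1.2 p.33] -/
theorem _root_.Literature.AnabelianGeometry.SemiGraphs.QuotientHomCosetDescription_holds :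
    QuotientHomCosetDescription G :=
  _root_.Literature.AnabelianGeometry.SemiGraphs.quotientHomCosetDescription_holds (G := G)

/-! ### Remark 3.1.2: countability of `Hom(T₁, T₂)` for connected `T₁` -/

/-- A connected object of `B^temp(Π)` has at most one orbit: otherwise it is the coproduct, in
`B^temp(Π)`, of an orbit and its (stable) complement, both nonempty. [folklore] -/
private theorem exists_ρ_eq_of_isConnectedObj (T : BTemp G)
    (hT : Literature.AlgebraicGeometry.Frobenioids.IsConnectedObj T) (x₀ x : T.obj.V) :
    ∃ g : G, T.obj.ρ g x₀ = x := by
  classical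
  letI : MulAction G T.obj.V := Action.instMulAction T.obj
  by_contra hx
  -- sub-`Π`-sets as objects of `B^temp(Π)`, with their inclusions
  let B : SubMulAction G T.obj.V → BTemp G := fun S =>
    ⟨{ V := S, ρ := (Action.ofMulAction G S).ρ }, by
      haveI : Countable T.obj.V := T.property.1
      refine ⟨inferInstanceAs (Countable S), fun (y : S) => ?_⟩
      change IsOpen {g : G | (Action.ofMulAction G S).ρ g y = y}
      have : {g : G | (Action.ofMulAction G S).ρ g y = y} = {g : G | T.obj.ρ g y.1 = y.1} := by
        ext g
        simp only [Set.mem_setOf_eq]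
        change g • y = y ↔ g • (y.1 : T.obj.V) = y.1
        rw [Subtype.ext_iff, SubMulAction.val_smul]
      rw [this]
      exact T.property.2 y.1⟩
  let ι : ∀ S : SubMulAction G T.obj.V, B S ⟶ T := fun S =>
    ObjectProperty.homMk
      { hom := TypeCat.ofHom fun y : S => (y.1 : T.obj.V)
        comm := fun _ => by
          apply ConcreteCategory.hom_ext
          intro y
          rfl }
  -- a sub-`Π`-set with a point is not initial (map it to the empty `Π`-set)
  have hne : ∀ (S : SubMulAction G T.obj.V) (_ : S),
      Literature.AlgebraicGeometry.Frobenioids.IsNonemptyObj (B S) := fun S y => by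
    constructor
    intro hI
    let E : BTemp G := ⟨{ V := PEmpty.{u + 1}, ρ := 1 }, ⟨inferInstance, fun z => z.elim⟩⟩
    exact ((hI.to E).hom.hom y : PEmpty).elim
  -- the orbit of `x₀` and its complement
  let S : SubMulAction G T.obj.V :=
    { carrier := MulAction.orbit G x₀
      smul_mem' := fun g {_} hy => MulAction.mem_orbit_of_mem_orbit g hy }
  let Sc : SubMulAction G T.obj.V :=
    { carrier := (S : Set T.obj.V)ᶜ
      smul_mem' := fun g {y} hy => by
        intro hgy
        apply hy
        have := S.smul_mem g⁻¹ hgy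
        rwa [inv_smul_smul] at this }
  have hx' : x ∈ Sc := fun ⟨g, hg⟩ => hx ⟨g, hg⟩
  -- `T = S ⊔ Sc` in `B^temp(Π)`
  let d : ∀ s : BinaryCofan (B S) (B Sc), T.obj.V → s.pt.obj.V := fun s y =>
    if hy : y ∈ S then s.inl.hom.hom (⟨y, hy⟩ : S) else s.inr.hom.hom (⟨y, hy⟩ : Sc)
  have hd₁ : ∀ s y (hy : y ∈ S), d s y = s.inl.hom.hom (⟨y, hy⟩ : S) := fun s y hy => by
    simp only [d, dif_pos hy]
  have hd₂ : ∀ s y (hy : y ∉ S), d s y = s.inr.hom.hom (⟨y, hy⟩ : Sc) := fun s y hy => by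
    simp only [d, dif_neg hy]
  have hcol : Nonempty (IsColimit (BinaryCofan.mk (ι S) (ι Sc))) := by
    refine ⟨BinaryCofan.isColimitMk
      (fun s => ObjectProperty.homMk
        { hom := TypeCat.ofHom (d s)
          comm := fun g => ?_ }) ?_ ?_ ?_⟩
    · apply ConcreteCategory.hom_ext
      intro y
      change d s (g • y) = s.pt.obj.ρ g (d s y)
      by_cases hy : y ∈ S
      · rw [hd₁ s y hy, hd₁ s (g • y) (S.smul_mem g hy)]
        exact ConcreteCategory.congr_hom (s.inl.hom.comm g) (⟨y, hy⟩ : S)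
      · rw [hd₂ s y hy, hd₂ s (g • y) (Sc.smul_mem g hy)]
        exact ConcreteCategory.congr_hom (s.inr.hom.comm g) (⟨y, hy⟩ : Sc)
    · intro s
      apply ObjectProperty.hom_ext
      apply Action.hom_ext
      apply ConcreteCategory.hom_ext
      intro y
      change d s (y.1 : T.obj.V) = s.inl.hom.hom y
      rw [hd₁ s y.1 y.2]
    · intro s
      apply ObjectProperty.hom_ext
      apply Action.hom_ext
      apply ConcreteCategory.hom_ext
      intro y
      change d s (y.1 : T.obj.V) = s.inr.hom.hom y
      rw [hd₂ s y.1 y.2]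
    · intro s m h₁ h₂
      apply ObjectProperty.hom_ext
      apply Action.hom_ext
      apply ConcreteCategory.hom_ext
      intro y
      change m.hom.hom y = d s y
      by_cases hy : y ∈ S
      · rw [hd₁ s y hy, ← h₁]
        rfl
      · rw [hd₂ s y hy, ← h₂]
        rfl
  -- contradiction with connectedness
  have h := hT.2 _ _ (ι S) (ι Sc) (hne S ⟨x₀, MulAction.mem_orbit_self x₀⟩) (hne Sc ⟨x, hx'⟩)
  exact h.false hcol.some

variable (G) in
/-- **Remark 3.1.2** (SemiAnbd §3 pp. 33–34), PROVED: "if `T₁, T₂` are objects of a temperoid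
`T`, and `T₁` is connected, then the set `Hom_T(T₁, T₂)` is countable", for `T = B^temp(Π)`:
a connected object is empty or a single orbit, so a `Π`-map out of it is determined by at most one
value in the countable set `T₂`. [cite: MochizukiSemiAnbd2006, Rmk 3.1.2 pp.33-34] -/
theorem countableHomOfConnected_holds : CountableHomOfConnected G := by
  intro _ T₁ T₂ hT₁
  haveI : Countable T₂.obj.V := T₂.property.1
  rcases isEmpty_or_nonempty T₁.obj.V with hE | ⟨⟨x₀⟩⟩
  · -- no points: at most one morphism
    haveI : Subsingleton (T₁ ⟶ T₂) := ⟨fun f f' =>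
      ObjectProperty.hom_ext _ (Action.hom_ext _ _
        (ConcreteCategory.hom_ext _ _ fun x => (hE.false x).elim))⟩
    infer_instance
  · -- one orbit: evaluation at `x₀` is injective
    refine Function.Injective.countable (f := fun f : T₁ ⟶ T₂ => (f.hom.hom x₀ : T₂.obj.V)) ?_
    intro f f' hff'
    apply ObjectProperty.hom_ext
    apply Action.hom_ext
    apply ConcreteCategory.hom_ext
    intro x
    obtain ⟨g, rfl⟩ := exists_ρ_eq_of_isConnectedObj T₁ hT₁ x₀ x
    have h₁ : (f.hom.hom (T₁.obj.ρ g x₀) : T₂.obj.V) = T₂.obj.ρ g (f.hom.hom x₀) :=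
      ConcreteCategory.congr_hom (f.hom.comm g) x₀
    have h₂ : (f'.hom.hom (T₁.obj.ρ g x₀) : T₂.obj.V) = T₂.obj.ρ g (f'.hom.hom x₀) :=
      ConcreteCategory.congr_hom (f'.hom.comm g) x₀
    have h₃ : (f.hom.hom x₀ : T₂.obj.V) = f'.hom.hom x₀ := hff'
    rw [h₁, h₂, h₃]

variable (G) in
/-- `CountableHomOfConnected` — `_holds` alias of `countableHomOfConnected_holds` above under the fact's exact name (appended
2026-08-28, D-0026 bookkeeping: the proof term is the existing theorem of this file; no statement,
definition or attribute is edited; no new named fact; the ledger's debt table listed the fact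
unproved). [cite: MochizukiSemiAnbd2006, Rmk 3.1.2 pp.33-34] -/
theorem _root_.Literature.AnabelianGeometry.SemiGraphs.CountableHomOfConnected_holds :
    CountableHomOfConnected G :=
  _root_.Literature.AnabelianGeometry.SemiGraphs.countableHomOfConnected_holds (G := G)

/-! ### Remark 3.1.1: countable generation -/

variable (G) in
/-- **Remark 3.1.1**, second sentence (SemiAnbd §3 p. 33), PROVED: a tempered group admitting a
countable system `N n` of open normal subgroups of countable index, cofinal among the
neighbourhoods of `1`, is topologically generated by a countable set — indeed the union over `n`
of a set of coset representatives of `Π/N n` is countable and already dense.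
[cite: MochizukiSemiAnbd2006, Rmk 3.1.1 p.33] -/
theorem countablyGeneratedOfCountableSystem_holds [IsTopologicalGroup G] :
    CountablyGeneratedOfCountableSystem G := by
  intro _ N _ hcof
  let S : Set G := ⋃ n, Set.range fun q : G ⧸ (N n).toSubgroup => q.out
  have hS : S.Countable := Set.countable_iUnion fun n => Set.countable_range _
  refine ⟨S, hS, ?_⟩
  -- `S` is dense
  have hdense : Dense S := by
    intro g
    rw [mem_closure_iff_nhds]
    intro U hU
    have hU1 : (fun x => g * x) ⁻¹' U ∈ 𝓝 (1 : G) := by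
      have hc : Continuous fun x : G => g * x := continuous_const_mul g
      exact hc.continuousAt.preimage_mem_nhds (by simpa using hU)
    obtain ⟨n, hn⟩ := hcof _ hU1
    obtain ⟨h, hh⟩ := QuotientGroup.mk_out_eq_mul (N n).toSubgroup g
    refine ⟨g * h, ?_, Set.mem_iUnion.mpr ⟨n, (g : G ⧸ (N n).toSubgroup), hh⟩⟩
    exact hn h.2
  rw [eq_top_iff]
  intro g _
  change g ∈ _root_.closure ((Subgroup.closure S : Subgroup G) : Set G)
  exact hdense.mono Subgroup.subset_closure g

end Literature.AnabelianGeometry.SemiGraphs
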